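import Mathlib.RingTheory.Ideal.Norm.AbsNorm
import Literature.RingTheory.DedekindDomain.BlockIdempotentFamily      -- ★ (O-CRT) p846342: `pow_inf_pow_eq_span_pow`, absorption lemmas
import HarnessLib

/-!
# Fixed points of the block idempotent `a_n` on `(O ∕ pⁿ)^m`: they are `(O ∕ w^{en})^m`, of cardinality `p^{m·e·f·n}`

Topic `Literature/RingTheory/DedekindDomain`; namespace `Literature.RingTheory.DedekindDomain`.  THEOREMS ONLY (no definition, no named fact, no instance,
no notation, no `sorry`); Mathlib + ★ `BlockIdempotentFamily`.  Cell `hodgecm-mathlib` (D-0151), P6 «MOD programme», K∕BT cut v2.3 DEAL 7 «(S-H-alg)»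
(F0P6d-plan (g2) → B-p12 (g32)): the ARITHMETIC half of GEN's socket (S-H) «block height `2ef`» — with DEAL 8 (`M ∕ pⁿM ≃ (O ∕ pⁿ)^m` for a projective `M`
of rank `m`) and the BT transport, GEN's only remaining input is «`A_Ω[pⁿ](Ω) ≅ (O ∕ pⁿ)²` as `O`-modules».  HC_CM is proved only modulo the printed
citations (2 remaining named inputs hLiu418, h413) until rung 0 closes; count-neutral.

THE PRINT.  [Neukirch1999] Ch. I §3 (3.6) (Chinese remainder theorem): for coprime ideals `𝔞`, `𝔟`, `O ∕ 𝔞𝔟 ≅ O ∕ 𝔞 × O ∕ 𝔟`; here `(p) = w^e · 𝔟` with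
`w ⊔ 𝔟 = O`, so `(pⁿ) = w^{en} ∩ 𝔟ⁿ` (★ `pow_inf_pow_eq_span_pow`) and the block idempotent family `a_n ≡ 1 (w^{en})`, `a_n ≡ 0 (𝔟ⁿ)` (★
`exists_blockIdempotentFamily`) is the CRT idempotent of the `w`-block: multiplication by `a_n` on `O ∕ pⁿ` is the projection onto the factor `O ∕ w^{en}`,
whose FIXED POINTS are exactly that factor.  Counting ([Neukirch1999] Ch. I §6: `𝔑(w^k) = 𝔑(w)^k` for a non-zero prime of a Dedekind domain; Mathlib
`cardQuot_pow_of_prime`): `#(O ∕ w^{en}) = (p^f)^{en}` when `#(O ∕ w) = p^f`, so the fixed points of `a_n` on `(O ∕ pⁿ)^m` number `p^{m·e·f·n}`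
(`m = 2`: `p^{n·2ef}`, the block height `h₁ = 2ef` of socket (S-H)).

WHAT IS HERE (`hx : (p) = w^e·𝔟`, `hcop : w ⊔ 𝔟 = ⊤`, `ha1 ∕ ha2` the block idempotent family): §1 `span_pow_le_pow_mul` ∕ `span_pow_le_pow`,
**`mk_mul_mk_eq_iff`** (`ā_n·b̄ = b̄ in O ∕ pⁿ ↔ b ∈ 𝔟ⁿ`), **`nonempty_fixedPoints_equiv_quotient_pow`** (`{x : O ∕ pⁿ ∕∕ ā_n x = x} ≃ O ∕ w^{en}`, built from
`O ∕ pⁿ ↠ O ∕ w^{en}` and `b̄ ↦ a_n b`); §2 (`O` Dedekind, `w ≠ ⊥` maximal, `#(O ∕ w) = p^f`) `natCard_quotient_pow_eq` (`#(O ∕ w^k) = p^{fk}`),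
`natCard_fixedPoints_blockIdempotent_one`, HEAD **`natCard_fixedPoints_blockIdempotent (m n)`** (`= p ^ (m * (e * f * n))`), `…_smul` (the `a n • x = x`
spelling), the transport rider **`natCard_fixedPoints_smul_of_linearEquiv`** (`M ≃ₗ[O] (Fin m → O ∕ pⁿ)` ⇒ fixed points of `a n •` on `M` number
`p ^ (m * (e * f * n))`) and its `m = 2` form `natCard_fixedPoints_smul_of_linearEquiv_two` (`= p ^ (n * (2 * e * f))`).

## References
* [Neukirch1999] J. Neukirch, *Algebraic Number Theory*, Grundlehren 322, Springer (1999) — Ch. I §3 (3.6); Ch. I §6 (6.1)–(6.2).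
-/

set_option autoImplicit false

namespace Literature.RingTheory.DedekindDomain

open Ideal

/-! ## §1 The fixed points of `a_n` on `O ∕ pⁿ` are the image of `𝔟ⁿ`, i.e. the factor `O ∕ w^{en}` -/

section Fixed

variable {O : Type*} [CommRing O] (w : Ideal O) {p : ℕ} {e : ℕ} {𝔟 : Ideal O}
  (hx : Ideal.span {(p : O)} = w ^ e * 𝔟) (hcop : w ⊔ 𝔟 = ⊤)
  (a : ℕ → O) (ha1 : ∀ n, a n - 1 ∈ w ^ (e * n)) (ha2 : ∀ n, a n ∈ 𝔟 ^ n)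

include hx hcop in
/-- `(pⁿ) ⊆ w^{en}`. [cite: Neukirch1999, Ch. I §3 (3.6)] -/
theorem span_pow_le_pow_mul (n : ℕ) : Ideal.span {(p : O) ^ n} ≤ w ^ (e * n) := by
  rw [← pow_inf_pow_eq_span_pow hx hcop n]
  exact inf_le_left

include hx hcop in
/-- `(pⁿ) ⊆ 𝔟ⁿ`. [cite: Neukirch1999, Ch. I §3 (3.6)] -/
theorem span_pow_le_pow (n : ℕ) : Ideal.span {(p : O) ^ n} ≤ 𝔟 ^ n := by
  rw [← pow_inf_pow_eq_span_pow hx hcop n]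
  exact inf_le_right

include hx hcop ha1 ha2 in
/-- **`ā_n · b̄ = b̄` in `O ∕ pⁿ` iff `b ∈ 𝔟ⁿ`**: `a_n b − b = (a_n − 1) b` lies in `w^{en}` always and in `𝔟ⁿ` iff `b` does (`a_n ∈ 𝔟ⁿ`), and
`(pⁿ) = w^{en} ∩ 𝔟ⁿ`. [cite: Neukirch1999, Ch. I §3 (3.6)] -/
theorem mk_mul_mk_eq_iff (n : ℕ) (b : O) :
    Ideal.Quotient.mk (Ideal.span {(p : O) ^ n}) (a n) * Ideal.Quotient.mk (Ideal.span {(p : O) ^ n}) b =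
      Ideal.Quotient.mk (Ideal.span {(p : O) ^ n}) b ↔ b ∈ 𝔟 ^ n := by
  rw [← map_mul, Ideal.Quotient.eq, ← pow_inf_pow_eq_span_pow hx hcop n, Ideal.mem_inf]
  have h1 : a n * b - b = (a n - 1) * b := by ring
  constructor
  · rintro ⟨-, h𝔟⟩
    have h2 : a n * b ∈ 𝔟 ^ n := Ideal.mul_mem_right _ _ (ha2 n)
    have h3 : b = a n * b - (a n * b - b) := by ring
    rw [h3]
    exact sub_mem h2 h𝔟
  · intro hb
    refine ⟨?_, ?_⟩
    · rw [h1]; exact Ideal.mul_mem_right _ _ (ha1 n)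
    · exact sub_mem (Ideal.mul_mem_left _ _ hb) hb

include hx hcop ha1 ha2 in
/-- **THE FIXED POINTS OF `a_n` ON `O ∕ pⁿ` ARE `O ∕ w^{en}`**: the projection `O ∕ pⁿ ↠ O ∕ w^{en}` restricted to `{x ∕∕ ā_n x = x}` is a bijection with inverse
`b̄ ↦ a_n b` (well defined: `w^{en} · a_n ⊆ (pⁿ)`; a fixed point: `a_n² ≡ a_n`; inverse: `a_n b ≡ b (w^{en})`, and `a_n b ≡ b (pⁿ)` for `b̄` fixed) — the CRT
projection onto the `w`-block. [cite: Neukirch1999, Ch. I §3 (3.6)] -/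
theorem nonempty_fixedPoints_equiv_quotient_pow (n : ℕ) :
    Nonempty ({x : O ⧸ Ideal.span {(p : O) ^ n} //
      Ideal.Quotient.mk (Ideal.span {(p : O) ^ n}) (a n) * x = x} ≃ O ⧸ w ^ (e * n)) := by
  -- the projection `π : O ∕ pⁿ → O ∕ w^{en}` and the section `σ : O ∕ w^{en} → O ∕ pⁿ`, `b̄ ↦ a_n b`
  let π : O ⧸ Ideal.span {(p : O) ^ n} →+* O ⧸ w ^ (e * n) := Ideal.Quotient.factor (span_pow_le_pow_mul w hx hcop n)
  have hσ : w ^ (e * n) ≤ LinearMap.ker ((Ideal.span {(p : O) ^ n}).mkQ ∘ₗ LinearMap.mulLeft O (a n)) := fun b hb => by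
    rw [LinearMap.mem_ker, LinearMap.comp_apply, LinearMap.mulLeft_apply, Submodule.mkQ_apply, Submodule.Quotient.mk_eq_zero,
      mul_comm]
    exact mul_mem_span_pow_of_mem_pow hx hcop ha2 n hb
  let σ : O ⧸ w ^ (e * n) →ₗ[O] O ⧸ Ideal.span {(p : O) ^ n} := (w ^ (e * n)).liftQ _ hσ
  have hσmk : ∀ b : O, σ (Ideal.Quotient.mk (w ^ (e * n)) b) = Ideal.Quotient.mk (Ideal.span {(p : O) ^ n}) (a n * b) := fun b => rfl
  have hπmk : ∀ b : O, π (Ideal.Quotient.mk (Ideal.span {(p : O) ^ n}) b) = Ideal.Quotient.mk (w ^ (e * n)) b := fun b => rfl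
  refine ⟨⟨fun x => π x.1, fun y => ⟨σ y, ?_⟩, ?_, ?_⟩⟩
  · -- `σ y` is fixed: `a_n (a_n b) ≡ a_n b` since `a_n² ≡ a_n (pⁿ)`
    obtain ⟨b, rfl⟩ := Ideal.Quotient.mk_surjective y
    rw [hσmk, ← map_mul, Ideal.Quotient.eq, ← mul_assoc, ← sub_mul]
    exact Ideal.mul_mem_right _ _ (mul_self_sub_mem_span_pow hx hcop ha1 ha2 n)
  · rintro ⟨x, hxfix⟩
    obtain ⟨b, rfl⟩ := Ideal.Quotient.mk_surjective x
    apply Subtype.ext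
    change σ (π (Ideal.Quotient.mk _ b)) = Ideal.Quotient.mk _ b
    rw [hπmk, hσmk, map_mul]
    exact hxfix
  · intro y
    obtain ⟨b, rfl⟩ := Ideal.Quotient.mk_surjective y
    change π (σ (Ideal.Quotient.mk _ b)) = Ideal.Quotient.mk _ b
    rw [hσmk, hπmk, Ideal.Quotient.eq]
    have h1 : a n * b - b = (a n - 1) * b := by ring
    rw [h1]
    exact Ideal.mul_mem_right _ _ (ha1 n)

end Fixed

/-! ## §2 Counting over a Dedekind domain with finite residue field `#(O ∕ w) = p^f` -/

section Count

variable {O : Type*} [CommRing O] [IsDedekindDomain O] (w : Ideal O) [w.IsMaximal] (hw0 : w ≠ ⊥) {p f : ℕ}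
  (hf : Nat.card (O ⧸ w) = p ^ f) {e : ℕ} {𝔟 : Ideal O}
  (hx : Ideal.span {(p : O)} = w ^ e * 𝔟) (hcop : w ⊔ 𝔟 = ⊤)
  (a : ℕ → O) (ha1 : ∀ n, a n - 1 ∈ w ^ (e * n)) (ha2 : ∀ n, a n ∈ 𝔟 ^ n)

include hw0 hf in
/-- **`#(O ∕ w^k) = p^{fk}`** for a non-zero prime `w` of a Dedekind domain with `#(O ∕ w) = p^f` (Mathlib `cardQuot_pow_of_prime`: the ideal norm is
multiplicative on prime powers). [cite: Neukirch1999, Ch. I §6 (6.1)–(6.2)] -/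
theorem natCard_quotient_pow_eq (k : ℕ) : Nat.card (O ⧸ w ^ k) = p ^ (f * k) := by
  rw [← Submodule.cardQuot_apply, cardQuot_pow_of_prime hw0, Submodule.cardQuot_apply, hf, ← pow_mul]

include hw0 hf hx hcop ha1 ha2 in
/-- **`#{x : O ∕ pⁿ ∕∕ ā_n x = x} = p^{efn}`** (`m = 1`). [cite: Neukirch1999, Ch. I §3 (3.6)] -/
theorem natCard_fixedPoints_blockIdempotent_one (n : ℕ) :
    Nat.card {x : O ⧸ Ideal.span {(p : O) ^ n} // Ideal.Quotient.mk (Ideal.span {(p : O) ^ n}) (a n) * x = x} = p ^ (e * f * n) := by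
  obtain ⟨ε⟩ := nonempty_fixedPoints_equiv_quotient_pow w hx hcop a ha1 ha2 n
  rw [Nat.card_congr ε, natCard_quotient_pow_eq w hw0 hf, show f * (e * n) = e * f * n by ring]

include hw0 hf hx hcop ha1 ha2 in
/-- **HEAD — `#{x : (O ∕ pⁿ)^m ∕∕ ā_n · x = x} = p^{m·(efn)}`**: the fixed points of the block idempotent on `(O ∕ pⁿ)^m` are counted coordinatewise
(`m` copies of `O ∕ w^{en}`). [cite: Neukirch1999, Ch. I §3 (3.6)] -/
theorem natCard_fixedPoints_blockIdempotent (m n : ℕ) :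
    Nat.card {x : Fin m → O ⧸ Ideal.span {(p : O) ^ n} //
      (fun i => Ideal.Quotient.mk (Ideal.span {(p : O) ^ n}) (a n) * x i) = x} = p ^ (m * (e * f * n)) := by
  let ε₁ : {x : Fin m → O ⧸ Ideal.span {(p : O) ^ n} // (fun i => Ideal.Quotient.mk (Ideal.span {(p : O) ^ n}) (a n) * x i) = x} ≃
      {x : Fin m → O ⧸ Ideal.span {(p : O) ^ n} // ∀ i, Ideal.Quotient.mk (Ideal.span {(p : O) ^ n}) (a n) * x i = x i} :=
    Equiv.subtypeEquivRight fun x => funext_iff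
  let ε₂ := (Equiv.subtypePiEquivPi (β := fun _ : Fin m => O ⧸ Ideal.span {(p : O) ^ n})
    (p := fun _ y => Ideal.Quotient.mk (Ideal.span {(p : O) ^ n}) (a n) * y = y))
  rw [Nat.card_congr (ε₁.trans ε₂), Nat.card_pi, Finset.prod_const, Finset.card_univ, Fintype.card_fin,
    natCard_fixedPoints_blockIdempotent_one w hw0 hf hx hcop a ha1 ha2 n, ← pow_mul, mul_comm]

include hw0 hf hx hcop ha1 ha2 in
/-- The same count in the `•` spelling: `a n • x = x` on the `O`-module `(O ∕ pⁿ)^m`. [cite: Neukirch1999, Ch. I §3 (3.6)] -/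
theorem natCard_fixedPoints_blockIdempotent_smul (m n : ℕ) :
    Nat.card {x : Fin m → O ⧸ Ideal.span {(p : O) ^ n} // a n • x = x} = p ^ (m * (e * f * n)) := by
  rw [← natCard_fixedPoints_blockIdempotent w hw0 hf hx hcop a ha1 ha2 m n]
  refine Nat.card_congr (Equiv.subtypeEquivRight fun x => ?_)
  have h : a n • x = fun i => Ideal.Quotient.mk (Ideal.span {(p : O) ^ n}) (a n) * x i := by
    funext i
    rw [Pi.smul_apply, Algebra.smul_def, Ideal.Quotient.algebraMap_eq]
  rw [h]

include hw0 hf hx hcop ha1 ha2 in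
/-- **TRANSPORT RIDER — any `O`-module isomorphic to `(O ∕ pⁿ)^m`**: if `ε : M ≃ₗ[O] (Fin m → O ∕ pⁿ)` (e.g. DEAL 8's `M ∕ pⁿM ≃ (O ∕ pⁿ)^m` for a projective
`M` of rank `m`, or GEN's `A_Ω[pⁿ](Ω)`), then the fixed points of `a n •` on `M` number `p^{m·(efn)}`. [cite: Neukirch1999, Ch. I §3 (3.6)] -/
theorem natCard_fixedPoints_smul_of_linearEquiv {M : Type*} [AddCommGroup M] [Module O M] {m : ℕ} (n : ℕ)
    (ε : M ≃ₗ[O] (Fin m → O ⧸ Ideal.span {(p : O) ^ n})) :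
    Nat.card {y : M // a n • y = y} = p ^ (m * (e * f * n)) := by
  rw [← natCard_fixedPoints_blockIdempotent_smul w hw0 hf hx hcop a ha1 ha2 m n]
  refine Nat.card_congr (ε.toEquiv.subtypeEquiv fun y => ?_)
  constructor
  · intro h
    change a n • ε y = ε y
    rw [← map_smul, h]
  · intro h
    apply ε.injective
    rw [map_smul]
    exact h

include hw0 hf hx hcop ha1 ha2 in
/-- **The (S-H) exponent shape, `m = 2`**: `#{y ∈ M ∕∕ a_n • y = y} = p ^ (n · (2ef))` for `M ≃ₗ[O] (O ∕ pⁿ)²` — the block height `h₁ = 2ef`.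
[cite: Neukirch1999, Ch. I §3 (3.6)] -/
theorem natCard_fixedPoints_smul_of_linearEquiv_two {M : Type*} [AddCommGroup M] [Module O M] (n : ℕ)
    (ε : M ≃ₗ[O] (Fin 2 → O ⧸ Ideal.span {(p : O) ^ n})) :
    Nat.card {y : M // a n • y = y} = p ^ (n * (2 * e * f)) := by
  rw [natCard_fixedPoints_smul_of_linearEquiv w hw0 hf hx hcop a ha1 ha2 n ε, show 2 * (e * f * n) = n * (2 * e * f) by ring]

end Count

end Literature.RingTheory.DedekindDomain
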